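import Mathlib.Analysis.SpecialFunctions.Pow.Real
import Literature.IUT.LogVolume.Theorem110Data
import HarnessLib

/-!
# Joshi, *Arithmetic Teichmüller Spaces IV* (arXiv:2403.10430v2) §6.8–§6.11: upper bounds for the theta-values locus —
# Lemma 6.7.8, Prop 6.8.1, Props 6.10.9/6.10.10/6.10.12, (6.11.1)–(6.11.7), Thm 6.10.1 with `C_Θ` as printed — TYPED;
# the real-number assembly of §6.8/§6.11 PROVED

Record file of the abc-iut cell, branch E «type Joshi's construction, test vs S» (rung LADDER-ABC:A2.E; seat abc-iut-E-t31, slot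
T-31; plan/E/t31/INVENTORY.tsv). **No side is taken** on [IUTchIII] Cor. 3.12, on Joshi's claims, or on Mochizuki's report on them;
the source is an unrefereed arXiv preprint («Preliminary version for comments»). TYPED ≠ PROVED ≠ ENDORSED: every assertion of the
paper is a `Prop`-valued READING PREDICATE carrying its locator (render `HOME/lit/renders/Joshi-arxiv-2403.10430/pNNNN.txt`, «p.N
l.M» = line M of PDF page N); nothing of the paper is asserted. PROVED is only the real-number bookkeeping by which §6.8/§6.11 pass
from NAMED inputs to Prop 6.8.1, (6.11.2), (6.11.6) and the displayed chain of Thm 6.10.1 — the kernel records which inputs carry it.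
Notation (§4.1.1–4.1.2 p.37 l.24 – p.38 l.9): `ℓ ≥ 5` prime, `ℓ* = (ℓ−1)/2`, `d_mod = [L_mod : ℚ]`, `e*_mod = 2¹²·3³·5·e_mod`, `η_prm`
(Prop 6.2.1: «:= 60»). p.59 l.20–24: «My estimates for constants arising from the wild ramification term …, indicated in blue, is
different from Mochizuki's and is indicated in red» — in the PDF text layer the blue|red pairs read «4|2·log(ℓ)», «74|46», «80|52»,
«80|56»; BOTH are typed (`…` = blue = Joshi's, `…Red` = red = as Joshi prints Mochizuki's).

What the typing records (numbers, not adjectives; located, not adjudicated):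
1. (6.11.2) ⟹ (6.11.6) is PROVED with the BLUE constants from the named inputs Prop 6.8.1 and Lemma 6.7.8 for every `ℓ ≥ 5`,
   `e*_mod ≥ 2¹²·3³·5`, `η_prm ≥ 0`, `log(q) ≥ 0` (slack used: `4·log ℓ + 84 ≤ (10/9)(e*_mod·ℓ + η_prm)`). The printed intermediate
   constant of (6.11.3)/(6.11.4) absorbs the «+ (ℓ+1)» of (6.11.2) as «52 → 56» in red but keeps «80» in blue (the same absorption
   gives 84); (6.11.6) has no additive constant and is unaffected.
2. The displayed chain of Thm 6.10.1 follows from (6.11.6), «(1/2ℓ) log(q) = |log(q_ℓ)|» (p.71 l.107–110), the lower bound (Cor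
   9.11.1.1 computed with φ(y₀)) and the two Frobenius-shift equalities; the RHS of (6.11.6) is LITERALLY `C_Θ·|log(q_ℓ)|`.
3. Props 6.10.10 and 6.10.12 AS PRINTED (absolute-value bars; sign convention [J-III] §9.11.1) hold for every datum; the intended
   content (local log-volume `≤ 0`, the archimedean bound) is recorded separately as OUR READING.
4. [IUTchIV] twins in OUR Literature (locators only): `Literature.IUT.LogVolume.Thm110Numerics.CTheta` is the same printed `C_Θ`;
   `.ProofData.sQ_le` = (6.8.11); `.stepiii_final` = Prop 6.8.1 (red); `.ProofData.hull_le` = Steps (iv)–(vii) summed, where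
   [IUTchIV] has `l*_mod := log(e*_mod·l)` (`.lstar`) at the place Lemma 6.7.8 / Prop 6.10.9 print `e*_mod`, and `𝔰^≤` with
   coefficient `ι/log(p_v)` where (6.7.6) prints `ι_v/p_v`.

Binding-point rule (E-PLAN R14): imports Mathlib / Literature only; OUR frozen decls are NAMED in docstrings (lower bound: shape of
`Summit.ABC.IUTFork.Cor312.Setting.Statement`; per place `w` it is E-t4's `Summit.ABC.IUTFork.Joshi.ATS3.AdelicLocusDatum.Cor91111`;
the per-`w` ↔ per-`p` bundling is a dictionary row, not typed here). Merge-debts: slot T-30 (Thm 6.1.1 notation, Lemma 6.4.2, η_prm)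
enters as fields / named input predicates, never as restated decls; the prime-set / divisor level of §6.6–6.7 (V^dst, s, s^≤,
Lemma 6.10.5) is the sibling file `Joshi/ATS4RamificationDivisors.lean`. Shape (E-PLAN R2/R9): volume-shaped, S-bypassed (the chain
CONSUMES Cor 3.12); no TEST line issues from this file. [claim: Joshi2024ATS4, status: disputed]; [claim: Mochizuki2012, status:
disputed] for the [IUTchIV] locators.
-/

noncomputable section

open Finset

namespace Summit.ABC.IUTFork.Joshi.ATS4

/-! ## 1. The carrier: the real numbers §6.8–§6.11 read -/

/-- **Joshi's locus-volume datum** for ONE curve `C = C_λ` with Initial Theta Data (Thm 6.1.1 p.58 l.1–4; §4.1.1–4.1.2): `ℓ`,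
`d_mod`, `e*_mod` (`e_mod ≥ 1`), `η_prm`, the normalized degrees `log(d_{L_tpd})`, `log(f_{L_tpd})`, `log(d_{L′})`, `log(q)` (Tate
divisor §4.4, effective), `log(s_ℚ)`, `log(s^≤_ℚ)` ((6.7.2)–(6.7.7) p.61 l.31 – p.62 l.21), their `v_ℚ`-components on the finite set
`V^dst_ℚ` (Lemma 6.7.1; p.62 l.59–64), the local log-volumes `log Vol(hull(Θ̃^𝓘_{Mochizuki,p}))` at `p ∈ V^dst_ℚ` and `p = ∞` (p.67
l.51 – p.68 l.13), the global ones for the arithmeticoids `y₀` / `φ(y₀)` (p.65 l.40–52), and `|log(q_ℓ)|` of (6.11.7) (p.71 l.89–110)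
for `y₀` / `φ(y₀)` — OUR READING of (6.11.7): the real `Σ_w |log|q_w^{1/2ℓ}|_{L′_w}| > 0` (`V^{odd,ss} ≠ ∅`, `|q_w| < 1`). SIGNATURE
(data + printed ranges); nearest on OUR side: `Literature.IUT.LogVolume.Thm110Numerics` (+ `.ProofData`).
[claim: Joshi2024ATS4, status: disputed] -/
structure LocusVolumeDatum where
  /-- the prime `ℓ` -/ l : ℕ
  /-- `ℓ ≥ 5` (§4.1.2 (6)) -/ five_le_l : 5 ≤ l
  /-- `d_mod = [L_mod : ℚ]` -/ dmod : ℕ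
  /-- `d_mod ≥ 1` -/ one_le_dmod : 1 ≤ dmod
  /-- `e*_mod = 2¹²·3³·5·e_mod` -/ estar : ℝ
  /-- `e*_mod ≥ 2¹²·3³·5 = 552960` (`e_mod ≥ 1`) -/ estar_ge : 552960 ≤ estar
  /-- `η_prm` (`= 60`, Prop 6.2.1) -/ eta : ℝ
  /-- `η_prm ≥ 0` -/ eta_nonneg : 0 ≤ eta
  /-- `log(d_{L_tpd})` -/ logDiffTpd : ℝ
  /-- `log(d_{L_tpd}) ≥ 0` -/ logDiffTpd_nonneg : 0 ≤ logDiffTpd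
  /-- `log(f_{L_tpd})` -/ logCondTpd : ℝ
  /-- `log(f_{L_tpd}) ≥ 0` -/ logCondTpd_nonneg : 0 ≤ logCondTpd
  /-- `log(d_{L′})` -/ logDiffLp : ℝ
  /-- `log(q)`, normalized degree of the Tate divisor `q = q_{C/L}` (§4.4) -/ logq : ℝ
  /-- `log(q) ≥ 0` (the Tate divisor is effective) -/ logq_nonneg : 0 ≤ logq
  /-- `log(s_ℚ)` ((6.7.4)) -/ logsQ : ℝ
  /-- `log(s^≤_ℚ)` ((6.7.7)) -/ logsLe : ℝ
  /-- `V^dst_ℚ`, a finite set of rational primes (Lemma 6.7.1) -/ Vdst : Finset ℕ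
  /-- `log(d_{L′,v_ℚ})` -/ logDiffLpAt : ℕ → ℝ
  /-- `log(q_{v_ℚ})` -/ logqAt : ℕ → ℝ
  /-- `log(s_{ℚ,v_ℚ})` -/ logsQAt : ℕ → ℝ
  /-- `log(s^≤_{v_ℚ})` -/ logsLeAt : ℕ → ℝ
  /-- `log Vol(hull(Θ̃^𝓘_{Mochizuki,p}))` at a finite prime `p` (arithmeticoid `y₀`) -/ logVolAt : ℕ → ℝ
  /-- `log Vol(hull(Θ̃^𝓘_{Mochizuki,∞}))` -/ logVolArch : ℝ
  /-- `log Vol(hull(Θ̃^{𝓘,y₀}_Mochizuki))` (global) -/ logVolHull : ℝ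
  /-- `log Vol(hull(Θ̃^{𝓘,φ(y₀)}_Mochizuki))` (global, Frobenius-shifted arithmeticoid) -/ logVolHullFrob : ℝ
  /-- `|log(q_ℓ)| = |log(q^{y₀}_ℓ)|` of (6.11.7), computed with `y₀` -/ absLogThetaQ : ℝ
  /-- `|log(q_ℓ)| > 0` -/ absLogThetaQ_pos : 0 < absLogThetaQ
  /-- `|log(q^{φ(y₀)}_ℓ)|`, the same computed with `φ(y₀)` -/ absLogThetaQFrob : ℝ

namespace LocusVolumeDatum

variable (d : LocusVolumeDatum)

/-- `ℓ* = (ℓ − 1)/2` ([J-III] §3; [IUTchI] §0). [claim: Joshi2024ATS4, status: disputed] -/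
def lstar : ℝ := ((d.l : ℝ) - 1) / 2

/-- `ℓ ≥ 5` as a real inequality. [folklore] -/
theorem five_le_l_real : (5 : ℝ) ≤ d.l := by exact_mod_cast d.five_le_l

/-- `ℓ* ≥ 2 > 0`. [folklore] -/
theorem lstar_pos : 0 < d.lstar := by unfold lstar; have := d.five_le_l_real; linarith

/-! ## 2. §6.7–§6.8: Lemma 6.7.8, Prop 6.8.1 and its two printed inputs -/

/-- **Lemma 6.7.8** (p.62 l.22–27): «e*_mod·log(s^≤) ≤ (4/3)(e*_mod·ℓ + η_prm)». READING PREDICATE. ([IUTchIV] twin: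
`Thm110Numerics.ProofData.sLe_le` + `Theorem110.stepviii_pnt`, with `l*_mod = log(e*_mod·l)` in place of `e*_mod`.)
[claim: Joshi2024ATS4, status: disputed] -/
@[claim "Joshi2024ATS4" "disputed"]
def Lem678 : Prop := d.estar * d.logsLe ≤ 4 / 3 * (d.estar * d.l + d.eta)

/-- **Lemma 6.4.2 (2)** (p.60 l.7–21, blue): «(1 + 4/ℓ) log(d_{L′}) ≤ (1 + 4/ℓ)(log(d_{L_tpd}) + log(f_{L_tpd})) + 4·log(ℓ) + 74». Slot
T-30's node; here only the NAMED INPUT of Prop 6.8.1's proof (p.64 l.57). [claim: Joshi2024ATS4, status: disputed] -/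
@[claim "Joshi2024ATS4" "disputed"]
def Lem642₂ : Prop :=
  (1 + 4 / (d.l : ℝ)) * d.logDiffLp ≤ (1 + 4 / (d.l : ℝ)) * (d.logDiffTpd + d.logCondTpd) + 4 * Real.log d.l + 74

/-- **(6.8.11)** (p.64 l.2–3): «log(s_ℚ) ≤ 2·d_mod·(log(d_{L_tpd}) + log(f_{L_tpd})) + log(2·3·5·ℓ)» (argued p.63 l.6 – p.64 l.42 via
[Serre 1979, III Prop 13] and Thm 4.6.1). READING PREDICATE. ([IUTchIV] twin, verbatim: `Thm110Numerics.ProofData.sQ_le`.)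
[claim: Joshi2024ATS4, status: disputed] -/
@[claim "Joshi2024ATS4" "disputed"]
def Eq6811 : Prop := d.logsQ ≤ 2 * (d.dmod : ℝ) * (d.logDiffTpd + d.logCondTpd) + Real.log (2 * 3 * 5 * (d.l : ℝ))

/-- **Prop 6.8.1** (p.62 l.34–53), BLUE constants: «(1 + 4/ℓ)·log(d_{L′}) + (4/ℓ)·log(s_ℚ) ≤ (1 + 12·d_mod/ℓ)·(log(d_{L_tpd}) +
log(f_{L_tpd})) + 4·log(ℓ) + 80». READING PREDICATE (derived below from its two printed inputs).
[claim: Joshi2024ATS4, status: disputed] -/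
@[claim "Joshi2024ATS4" "disputed"]
def Prop681 : Prop :=
  (1 + 4 / (d.l : ℝ)) * d.logDiffLp + 4 / (d.l : ℝ) * d.logsQ ≤
    (1 + 12 * (d.dmod : ℝ) / d.l) * (d.logDiffTpd + d.logCondTpd) + 4 * Real.log d.l + 80

/-- **Prop 6.8.1 with the RED constants** as Joshi prints Mochizuki's: «… + 2·log(ℓ) + 52» (p.62 l.50–53; [IUTchIV] Step (iii)
final display, our PROVED `Thm110Numerics.stepiii_final`). READING PREDICATE. [claim: Joshi2024ATS4, status: disputed] -/
@[claim "Joshi2024ATS4" "disputed"]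
def Prop681Red : Prop :=
  (1 + 4 / (d.l : ℝ)) * d.logDiffLp + 4 / (d.l : ℝ) * d.logsQ ≤
    (1 + 12 * (d.dmod : ℝ) / d.l) * (d.logDiffTpd + d.logCondTpd) + 2 * Real.log d.l + 52

/-- **(6.8.17), (6.8.19)** (p.64 l.43–56): «Using log(2·3·5) < 5 … multiplying by 4/ℓ … as ℓ ≥ 5, so 20/ℓ ≤ 4 and log(ℓ)/ℓ ≤ 1/2
… (4/ℓ)·log(s_ℚ) ≤ (8/ℓ)·d_mod·(log(d_{L_tpd}) + log(f_{L_tpd})) + 6». PROVED from (6.8.11). [claim: Joshi2024ATS4, status: disputed] -/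
theorem eq6819_of (h : d.Eq6811) :
    4 / (d.l : ℝ) * d.logsQ ≤ 8 / (d.l : ℝ) * (d.dmod : ℝ) * (d.logDiffTpd + d.logCondTpd) + 6 := by
  unfold Eq6811 at h
  have hl5 := d.five_le_l_real
  have hl : (0 : ℝ) < d.l := by linarith
  have h30 := Literature.IUT.LogVolume.log_thirty_mul_le hl
  have h17 : d.logsQ ≤ 2 * (d.dmod : ℝ) * (d.logDiffTpd + d.logCondTpd) + 5 + Real.log d.l := by linarith
  have h1 := mul_le_mul_of_nonneg_left h17 (show 0 ≤ 4 / (d.l : ℝ) by positivity)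
  have e1 : 4 / (d.l : ℝ) * (2 * (d.dmod : ℝ) * (d.logDiffTpd + d.logCondTpd) + 5 + Real.log d.l) =
      8 / (d.l : ℝ) * (d.dmod : ℝ) * (d.logDiffTpd + d.logCondTpd) + 20 / d.l + 4 * (Real.log d.l / d.l) := by
    field_simp; ring
  rw [e1] at h1
  have h20 : 20 / (d.l : ℝ) ≤ 4 := by rw [div_le_iff₀ hl]; linarith
  have hll : Real.log (d.l : ℝ) / d.l ≤ 1 / 2 := Literature.IUT.LogVolume.log_div_self_le_half hl
  linarith

/-- **Prop 6.8.1 from its printed inputs** (the step (6.8.19) + Lemma 6.4.2 (2) ⟹ (6.8.20), p.64 l.57–74; uses `d_mod ≥ 1` to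
absorb `4/ℓ + 8·d_mod/ℓ ≤ 12·d_mod/ℓ`): `Lem642₂ ∧ Eq6811 ⟹ Prop681`. PROVED. [claim: Joshi2024ATS4, status: disputed] -/
theorem prop681_of (h₁ : d.Lem642₂) (h₂ : d.Eq6811) : d.Prop681 := by
  unfold Prop681; unfold Lem642₂ at h₁
  have hl5 := d.five_le_l_real
  have hl : (0 : ℝ) < d.l := by linarith
  have hd : (1 : ℝ) ≤ d.dmod := by exact_mod_cast d.one_le_dmod
  have h19 := d.eq6819_of h₂
  have hT : 0 ≤ d.logDiffTpd + d.logCondTpd := add_nonneg d.logDiffTpd_nonneg d.logCondTpd_nonneg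
  have h3 : 4 / (d.l : ℝ) * (d.logDiffTpd + d.logCondTpd) ≤ 4 * (d.dmod : ℝ) / d.l * (d.logDiffTpd + d.logCondTpd) := by
    apply mul_le_mul_of_nonneg_right _ hT
    rw [div_le_div_iff_of_pos_right hl]; linarith
  have e1 : (1 + 4 / (d.l : ℝ)) * (d.logDiffTpd + d.logCondTpd) =
      (d.logDiffTpd + d.logCondTpd) + 4 / (d.l : ℝ) * (d.logDiffTpd + d.logCondTpd) := by ring
  have e2 : (1 + 12 * (d.dmod : ℝ) / d.l) * (d.logDiffTpd + d.logCondTpd) =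
      (d.logDiffTpd + d.logCondTpd) + 4 * (d.dmod : ℝ) / d.l * (d.logDiffTpd + d.logCondTpd)
        + 8 / (d.l : ℝ) * (d.dmod : ℝ) * (d.logDiffTpd + d.logCondTpd) := by ring
  rw [e1] at h₁; rw [e2]
  linarith

/-- The red constants are the stronger reading: `Prop681Red ⟹ Prop681` (`log ℓ ≥ 0`). PROVED. [claim: Joshi2024ATS4, status: disputed] -/
theorem prop681_of_red (h : d.Prop681Red) : d.Prop681 := by
  have hlog : 0 ≤ Real.log (d.l : ℝ) := Real.log_nonneg (by have := d.five_le_l_real; linarith)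
  unfold Prop681; unfold Prop681Red at h; linarith

/-! ## 3. §6.10: the three local bounds, as printed -/

/-- **Prop 6.10.9** (p.69 l.1–28), at `p = v_ℚ ∈ V^dst_ℚ`: «−(1/ℓ*)·|log Vol(Θ̃^𝓘_{Mochizuki,p})| ≤ ((ℓ+1)/4)·{(1 + 4/ℓ)·log(d_{L′,v_ℚ})
− (1/6)·log(q_{v_ℚ}) + (4/ℓ)·log(s_{ℚ,v_ℚ}) + (20/3)·e*_mod·log(s^≤_{v_ℚ})}» («[IUTchIV] Step (v) p.658»). READING PREDICATE; never
asserted. ([IUTchIV] twin: `Thm110Numerics.ProofData.hull_le`, summed, with `l*_mod`.) [claim: Joshi2024ATS4, status: disputed] -/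
@[claim "Joshi2024ATS4" "disputed"]
def Prop6109 (p : ℕ) : Prop :=
  -(1 / d.lstar) * |d.logVolAt p| ≤ ((d.l : ℝ) + 1) / 4 *
    ((1 + 4 / (d.l : ℝ)) * d.logDiffLpAt p - 1 / 6 * d.logqAt p + 4 / (d.l : ℝ) * d.logsQAt p
      + 20 / 3 * d.estar * d.logsLeAt p)

/-- **Prop 6.10.10 as printed** (p.69 l.29–44), at `p ∈ V^non_ℚ − V^dst_ℚ`: «−(1/ℓ*)·|log Vol(Θ̃^𝓘_{Mochizuki,p})| ≤ 0» ([IUTchIV] Step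
(vi)). With the bars and `ℓ* > 0` this holds for EVERY datum (`prop61010_holds`); the intended content is `LocalLogVolNonposAt`.
[claim: Joshi2024ATS4, status: disputed] -/
@[claim "Joshi2024ATS4" "disputed"]
def Prop61010 (p : ℕ) : Prop := -(1 / d.lstar) * |d.logVolAt p| ≤ 0

/-- OUR READING of the content of Prop 6.10.10 / [IUTchIV] Step (vi) (sign convention [J-III] §9.11.1 «if 0 < x ≤ 1, −|log x| =
log x»): the local log-volume at `p ∉ V^dst_ℚ` is `≤ 0`. Not a printed display; never asserted. [claim: Joshi2024ATS4, status: disputed] -/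
def LocalLogVolNonposAt (p : ℕ) : Prop := d.logVolAt p ≤ 0

/-- **Prop 6.10.12 as printed** (p.69 l.54–68), at `p = ∞`: «−(1/ℓ*)·|log Vol(Θ̃^𝓘_{Mochizuki,p})| ≤ (ℓ + 1)» ([IUTchIV] Step (vii)).
Holds for every datum (`prop61012_holds`); intended content `ArchLogVolBound`. [claim: Joshi2024ATS4, status: disputed] -/
@[claim "Joshi2024ATS4" "disputed"]
def Prop61012 : Prop := -(1 / d.lstar) * |d.logVolArch| ≤ (d.l : ℝ) + 1

/-- OUR READING of the content of Prop 6.10.12 without bars: `−(1/ℓ*)·log Vol(hull(Θ̃^𝓘_∞)) ≤ ℓ + 1` ([IUTchIV] Step (vii) has the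
term `((l+5)/4)·log(π) ≤ ℓ + 1`; `Literature.IUT.LogVolume.log_pi_le_two`). Never asserted. [claim: Joshi2024ATS4, status: disputed] -/
def ArchLogVolBound : Prop := -(1 / d.lstar) * d.logVolArch ≤ (d.l : ℝ) + 1

/-- Prop 6.10.10 AS PRINTED holds for every datum: `−(1/ℓ*)·|x| ≤ 0` (a real-number tautology). PROVED. [folklore] -/
theorem prop61010_holds (p : ℕ) : d.Prop61010 p := by
  have h1 : 0 ≤ 1 / d.lstar := (one_div_pos.mpr d.lstar_pos).le
  unfold Prop61010; nlinarith [abs_nonneg (d.logVolAt p)]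

/-- Prop 6.10.12 AS PRINTED holds for every datum: `−(1/ℓ*)·|x| ≤ 0 ≤ ℓ + 1`. PROVED. [folklore] -/
theorem prop61012_holds : d.Prop61012 := by
  have h1 : 0 ≤ 1 / d.lstar := (one_div_pos.mpr d.lstar_pos).le
  have h3 : (0 : ℝ) ≤ d.l := by have := d.five_le_l_real; linarith
  unfold Prop61012; nlinarith [abs_nonneg d.logVolArch]

/-! ## 4. §6.11: from the local bounds to (6.11.6) -/

/-- **(6.11.1)** (p.69 l.73 – p.70 l.3): «−(1/ℓ*)·|log Vol(hull(Θ̃^𝓘_Mochizuki))| = −(1/ℓ*)·(Σ_{p ∈ V^dst_ℚ} |log Vol(hull(Θ̃^𝓘_p))| +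
|log Vol(hull(Θ̃^𝓘_∞))|)» «by definition (for the notational conventions see [J-III] §9.11.1) … with primes v_ℚ ∉ V^dst_ℚ ∪ {∞}
contributing a zero by Proposition 6.10.10». READING PREDICATE (an equality: it needs the dropped contributions to VANISH, which
Prop 6.10.10 as printed does not say — located, not adjudicated). [claim: Joshi2024ATS4, status: disputed] -/
@[claim "Joshi2024ATS4" "disputed"]
def Eq6111 : Prop :=
  -(1 / d.lstar) * |d.logVolHull| = -(1 / d.lstar) * (∑ p ∈ d.Vdst, |d.logVolAt p| + |d.logVolArch|)

/-- OUR READING of «log(d_{L′}), log(q), log(s_ℚ), log(s^≤) are the sums of their v_ℚ-components over V^dst_ℚ» (supports: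
d_{L′} on ramified primes and q on Supp(q_L), both ⊂ V^dst by Lemma 6.7.1 (2)/(4); s_ℚ, s^≤ by (6.7.2), (6.7.6)) — the bookkeeping
that turns the sum of Prop 6.10.9 over `V^dst_ℚ` into (6.11.2) (p.70 l.4–29). Untagged; never asserted.
[claim: Joshi2024ATS4, status: disputed] -/
def ComponentSums : Prop :=
  ∑ p ∈ d.Vdst, d.logDiffLpAt p = d.logDiffLp ∧ ∑ p ∈ d.Vdst, d.logqAt p = d.logq ∧
    ∑ p ∈ d.Vdst, d.logsQAt p = d.logsQ ∧ ∑ p ∈ d.Vdst, d.logsLeAt p = d.logsLe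

/-- **(6.11.2)** (p.70 l.4–29): «−(1/ℓ*)·|log Vol(hull(Θ̃^𝓘))| ≤ ((ℓ+1)/4)·{(1 + 4/ℓ)·log(d_{L′}) − (1/6)·log(q_ℚ) + (4/ℓ)·log(s_ℚ) +
(20/3)·e*_mod·log(s^≤_ℚ)} + (ℓ + 1)». Derived display (PROVED below from its inputs). [claim: Joshi2024ATS4, status: disputed] -/
@[claim "Joshi2024ATS4" "disputed"]
def Ineq6112 : Prop :=
  -(1 / d.lstar) * |d.logVolHull| ≤ ((d.l : ℝ) + 1) / 4 *
    ((1 + 4 / (d.l : ℝ)) * d.logDiffLp - 1 / 6 * d.logq + 4 / (d.l : ℝ) * d.logsQ + 20 / 3 * d.estar * d.logsLe)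
      + ((d.l : ℝ) + 1)

/-- **(6.11.2) from (6.11.1), Prop 6.10.9 on `V^dst_ℚ`, Prop 6.10.12 (as printed, automatic) and the component sums.** PROVED
(finite-sum bookkeeping). [claim: Joshi2024ATS4, status: disputed] -/
theorem ineq6112_of (h₁ : d.Eq6111) (h₂ : ∀ p ∈ d.Vdst, d.Prop6109 p) (h₃ : d.ComponentSums) : d.Ineq6112 := by
  unfold Ineq6112; unfold Eq6111 at h₁
  obtain ⟨hD, hq, hs, hsl⟩ := h₃
  have hA := d.prop61012_holds; unfold Prop61012 at hA
  have hsum : ∑ p ∈ d.Vdst, -(1 / d.lstar) * |d.logVolAt p| ≤ ∑ p ∈ d.Vdst, ((d.l : ℝ) + 1) / 4 *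
      ((1 + 4 / (d.l : ℝ)) * d.logDiffLpAt p - 1 / 6 * d.logqAt p + 4 / (d.l : ℝ) * d.logsQAt p
        + 20 / 3 * d.estar * d.logsLeAt p) := Finset.sum_le_sum fun p hp => h₂ p hp
  have e1 : ∑ p ∈ d.Vdst, ((d.l : ℝ) + 1) / 4 *
      ((1 + 4 / (d.l : ℝ)) * d.logDiffLpAt p - 1 / 6 * d.logqAt p + 4 / (d.l : ℝ) * d.logsQAt p
        + 20 / 3 * d.estar * d.logsLeAt p) = ((d.l : ℝ) + 1) / 4 *
      ((1 + 4 / (d.l : ℝ)) * d.logDiffLp - 1 / 6 * d.logq + 4 / (d.l : ℝ) * d.logsQ + 20 / 3 * d.estar * d.logsLe) := by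
    rw [← hD, ← hq, ← hs, ← hsl, ← Finset.mul_sum, Finset.sum_add_distrib, Finset.sum_add_distrib, Finset.sum_sub_distrib,
      Finset.mul_sum, Finset.mul_sum, Finset.mul_sum, Finset.mul_sum]
  have e2 : -(1 / d.lstar) * (∑ p ∈ d.Vdst, |d.logVolAt p| + |d.logVolArch|) =
      ∑ p ∈ d.Vdst, -(1 / d.lstar) * |d.logVolAt p| + -(1 / d.lstar) * |d.logVolArch| := by
    rw [mul_add, Finset.mul_sum]
  rw [h₁, e2]
  linarith

/-- **(6.11.6)** (p.71 l.53–88): «−(1/ℓ*)·|log Vol(hull(Θ̃^𝓘_Mochizuki))| ≤ ((ℓ+1)/4)·{−(1/6)·(1 − 12/ℓ²)·log(q) + (1 + 12·d_mod/ℓ)·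
(log(d_{L_tpd}) + log(f_{L_tpd})) + 10·(e*_mod·ℓ + η_prm)} − (1/2ℓ) log(q)». Derived display (PROVED below).
[claim: Joshi2024ATS4, status: disputed] -/
@[claim "Joshi2024ATS4" "disputed"]
def Ineq6116 : Prop :=
  -(1 / d.lstar) * |d.logVolHull| ≤ ((d.l : ℝ) + 1) / 4 *
    (-(1 / 6) * (1 - 12 / (d.l : ℝ) ^ 2) * d.logq + (1 + 12 * (d.dmod : ℝ) / d.l) * (d.logDiffTpd + d.logCondTpd)
      + 10 * (d.estar * d.l + d.eta)) - 1 / (2 * (d.l : ℝ)) * d.logq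

/-- **(6.11.2) ∧ Prop 6.8.1 (blue) ∧ Lemma 6.7.8 ⟹ (6.11.6)** — the content of (6.11.3)–(6.11.5) (p.70 l.30 – p.71 l.52: Prop 6.8.1,
the «elementary algebra» `(ℓ+1)/4·(1/6)(12/ℓ²) − 1/(2ℓ) = 1/(2ℓ²) > 0` on the `log q` term, Lemma 6.7.8, «≤ 10·(e*_mod·ℓ + η_prm)»).
PROVED for every datum (`ℓ ≥ 5`, `e*_mod ≥ 2¹²·3³·5`, `η_prm ≥ 0`, `log q ≥ 0`); the «+ (ℓ+1)» of (6.11.2) is absorbed as `((ℓ+1)/4)·4`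
and the slack used is `4·log ℓ + 84 ≤ (10/9)·(e*_mod·ℓ + η_prm)`. [claim: Joshi2024ATS4, status: disputed] -/
theorem ineq6116_of (h : d.Ineq6112) (hP : d.Prop681) (hL : d.Lem678) : d.Ineq6116 := by
  unfold Ineq6116; unfold Ineq6112 at h; unfold Prop681 at hP; unfold Lem678 at hL
  have hl5 := d.five_le_l_real
  have hl : (0 : ℝ) < d.l := by linarith
  have hL4 : 0 ≤ ((d.l : ℝ) + 1) / 4 := by positivity
  have he := d.estar_ge
  have hη := d.eta_nonneg
  have hq := d.logq_nonneg
  have hlog : Real.log (d.l : ℝ) ≤ d.l := (Real.log_le_sub_one_of_pos hl).trans (by linarith)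
  -- the product `e*_mod·ℓ` dominates everything additive
  have hel : 552960 * (d.l : ℝ) ≤ d.estar * d.l := mul_le_mul_of_nonneg_right he hl.le
  have hslack : 4 * Real.log (d.l : ℝ) + 84 + 20 / 3 * (d.estar * d.logsLe) ≤ 10 * (d.estar * d.l + d.eta) := by
    nlinarith
  -- multiply Prop 6.8.1 and the slack by `(ℓ+1)/4 ≥ 0`
  have h1 := mul_le_mul_of_nonneg_left hP hL4
  have h2 := mul_le_mul_of_nonneg_left hslack hL4
  -- the «elementary algebra» on the `log q` term: the excess is `log(q)/(2ℓ²) ≥ 0`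
  have key : ((d.l : ℝ) + 1) / 4 * (-(1 / 6) * (1 - 12 / (d.l : ℝ) ^ 2) * d.logq) - 1 / (2 * (d.l : ℝ)) * d.logq =
      ((d.l : ℝ) + 1) / 4 * (-(1 / 6) * d.logq) + d.logq / (2 * (d.l : ℝ) ^ 2) := by
    field_simp; ring
  have hexcess : 0 ≤ d.logq / (2 * (d.l : ℝ) ^ 2) := by positivity
  linarith

/-! ## 5. Thm 6.10.1: `C_Θ` verbatim, the displayed chain, and its assembly -/

/-- The braces of the printed `C_Θ` (Thm 6.10.1, p.66 l.44–61): `(1 + 12·d_mod/ℓ)·(deg(d_{L_tpd}) + deg(f_{L_tpd})) + 10(e*_mod·ℓ +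
η_prm) − (1/6)(1 − 12/ℓ²)·log(q)` (print has «deg» here and «log» in (6.11.6)/Thm 6.1.1 — one real). ([IUTchIV] twin, same formula:
`Thm110Numerics.bracket`.) [claim: Joshi2024ATS4, status: disputed] -/
def bracket : ℝ :=
  (1 + 12 * (d.dmod : ℝ) / d.l) * (d.logDiffTpd + d.logCondTpd) + 10 * (d.estar * d.l + d.eta)
    - 1 / 6 * (1 - 12 / (d.l : ℝ) ^ 2) * d.logq

/-- **`C_Θ` VERBATIM** (Thm 6.10.1, p.66 l.44–61): `C_Θ = (ℓ+1)/(4|log(q_ℓ)|)·{…} − 1`. ([IUTchIV] Thm 1.10 p.23 prints the same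
constant: `Thm110Numerics.CTheta`, `Summit.ABC.IUTFork.Thm110Data.CTheta`.) [claim: Joshi2024ATS4, status: disputed] -/
def CTheta : ℝ := ((d.l : ℝ) + 1) / (4 * d.absLogThetaQ) * d.bracket - 1

/-- «by the definition of q in §4.4 one sees that (1/2ℓ) log(q) = |log(q_ℓ)|» (p.71 l.107–110; Thm 6.10.1 «q^{y₀}_ℓ = (1/2ℓ)·log(q)»).
READING PREDICATE (dictionary between the Tate divisor's normalized degree and (6.11.7)); never asserted. ([IUTchIV] p.23:
`Thm110Numerics.absLogq := log(q)/(2l)` by definition.) [claim: Joshi2024ATS4, status: disputed] -/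
@[claim "Joshi2024ATS4" "disputed"]
def LogqDictionary : Prop := 1 / (2 * (d.l : ℝ)) * d.logq = d.absLogThetaQ

/-- Thm 6.10.1, first display (p.66 l.12–20): «−|log(q^{φ(y₀)}_ℓ)| = −|log(q^{y₀}_ℓ)|» («a consequence of the choice of the same global
normalization», p.67 l.35–37; Rmk 6.10.2). READING PREDICATE. [claim: Joshi2024ATS4, status: disputed] -/
@[claim "Joshi2024ATS4" "disputed"]
def FrobShiftQ : Prop := -|d.absLogThetaQFrob| = -|d.absLogThetaQ|

/-- Thm 6.10.1, the LOWER bound (p.66 l.22–30, l.41–43): «−|log(q^{y₀}_ℓ)| ≤ −(1/ℓ*)|log Vol(hull(Θ̃^{𝓘,φ(y₀)}_Mochizuki))| … given by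
[IUTchIII, Cor 3.12] via [J-III, Cor 9.11.1.1]» («computed using y′₀ = φ(y₀)», p.67 l.37–40). READING PREDICATE = the INPUT from E4
(E-t4's `Summit.ABC.IUTFork.Joshi.ATS3.AdelicLocusDatum.Cor91111`; shape of `Summit.ABC.IUTFork.Cor312.Setting.Statement`). Never
asserted. [claim: Joshi2024ATS4, status: disputed] -/
@[claim "Joshi2024ATS4" "disputed"]
def LowerBound : Prop := -|d.absLogThetaQ| ≤ -(1 / d.lstar) * |d.logVolHullFrob|

/-- Thm 6.10.1, middle equality (p.66 l.25–37): «−(1/ℓ*)|log Vol(hull(Θ̃^{𝓘,φ(y₀)}))| = −(1/ℓ*)|log Vol(hull(Θ̃^{𝓘,y₀}))|» («a tautology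
… identically normalized», p.67 l.45–47; Rmk 6.10.3: log-shift = Frobenius shift). READING PREDICATE. [claim: Joshi2024ATS4, status: disputed] -/
@[claim "Joshi2024ATS4" "disputed"]
def FrobShiftVol : Prop := -(1 / d.lstar) * |d.logVolHullFrob| = -(1 / d.lstar) * |d.logVolHull|

/-- Thm 6.10.1, the UPPER bound (p.66 l.31–40): «−(1/ℓ*)|log Vol(hull(Θ̃^{𝓘,y₀}_Mochizuki))| ≤ C_Θ·|log(q^{y₀}_ℓ)|». READING PREDICATE
(derived below from (6.11.6)). ([IUTchIV] twin: `Thm110Numerics.CThetaAdmissible`, `Thm110Data.MultiradialEstimate`.)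
[claim: Joshi2024ATS4, status: disputed] -/
@[claim "Joshi2024ATS4" "disputed"]
def UpperBound : Prop := -(1 / d.lstar) * |d.logVolHull| ≤ d.CTheta * |d.absLogThetaQ|

/-- **Thm 6.10.1 (The Second Main Bound), the displayed chain** (p.66 l.12–40), as the conjunction of its four displayed relations.
READING PREDICATE; never asserted. [claim: Joshi2024ATS4, status: disputed] -/
@[claim "Joshi2024ATS4" "disputed"]
def Thm6101 : Prop := d.FrobShiftQ ∧ d.LowerBound ∧ d.FrobShiftVol ∧ d.UpperBound

/-- The RHS of (6.11.6) IS `C_Θ·|log(q_ℓ)|` once «(1/2ℓ) log(q) = |log(q_ℓ)|» (p.71 l.103–114). PROVED. [claim: Joshi2024ATS4, status: disputed] -/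
theorem cTheta_mul_eq (hD : d.LogqDictionary) :
    d.CTheta * |d.absLogThetaQ| = ((d.l : ℝ) + 1) / 4 *
      (-(1 / 6) * (1 - 12 / (d.l : ℝ) ^ 2) * d.logq + (1 + 12 * (d.dmod : ℝ) / d.l) * (d.logDiffTpd + d.logCondTpd)
        + 10 * (d.estar * d.l + d.eta)) - 1 / (2 * (d.l : ℝ)) * d.logq := by
  have hA := d.absLogThetaQ_pos
  unfold LogqDictionary at hD
  rw [abs_of_pos hA, hD]
  unfold CTheta bracket
  field_simp
  ring

/-- **The upper bound of Thm 6.10.1 from (6.11.6)** and the dictionary sentence. PROVED. [claim: Joshi2024ATS4, status: disputed] -/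
theorem upperBound_of (h : d.Ineq6116) (hD : d.LogqDictionary) : d.UpperBound := by
  unfold UpperBound; rw [d.cTheta_mul_eq hD]; exact h

/-- **Thm 6.10.1 assembled** as §6.11 says (p.69 l.70–72, p.71 l.111–114): the two shift equalities, the lower bound (Cor 9.11.1.1),
(6.11.6) and «(1/2ℓ) log(q) = |log(q_ℓ)|» give the displayed chain. PROVED; inputs BY NAME. [claim: Joshi2024ATS4, status: disputed] -/
theorem thm6101_of (h₁ : d.FrobShiftQ) (h₂ : d.LowerBound) (h₃ : d.FrobShiftVol) (h₄ : d.Ineq6116)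
    (hD : d.LogqDictionary) : d.Thm6101 :=
  ⟨h₁, h₂, h₃, d.upperBound_of h₄ hD⟩

/-- **End to end**: (6.11.1), Prop 6.10.9 on `V^dst_ℚ`, the component sums, Lemma 6.4.2 (2), (6.8.11), Lemma 6.7.8, the lower bound,
the two shift equalities, the dictionary sentence ⟹ Thm 6.10.1 (all printed inputs of §6.8–6.11). PROVED. [claim: Joshi2024ATS4, status: disputed] -/
theorem thm6101_of_inputs (h₁ : d.Eq6111) (h₂ : ∀ p ∈ d.Vdst, d.Prop6109 p) (h₃ : d.ComponentSums) (h₄ : d.Lem642₂)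
    (h₅ : d.Eq6811) (h₆ : d.Lem678) (h₇ : d.LowerBound) (h₈ : d.FrobShiftQ) (h₉ : d.FrobShiftVol)
    (hD : d.LogqDictionary) : d.Thm6101 :=
  d.thm6101_of h₈ h₇ h₉ (d.ineq6116_of (d.ineq6112_of h₁ h₂ h₃) (d.prop681_of h₄ h₅) h₆) hD

/-- The displayed chain gives `C_Θ ≥ −1` (§6.12 p.72 l.13–15 «the (global) upper bound must be at least as big as the (global) lower
bound so … C_Θ ≥ −1»; [IUTchIV] twin `Theorem110.neg_one_le_CTheta`). PROVED. [claim: Joshi2024ATS4, status: disputed] -/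
theorem neg_one_le_cTheta (h : d.Thm6101) : -1 ≤ d.CTheta := by
  obtain ⟨-, h₂, h₃, h₄⟩ := h
  unfold LowerBound at h₂; unfold FrobShiftVol at h₃; unfold UpperBound at h₄
  have hA := d.absLogThetaQ_pos
  rw [abs_of_pos hA] at h₂ h₄
  have hle : -d.absLogThetaQ ≤ d.CTheta * d.absLogThetaQ := h₂.trans (h₃.le.trans h₄)
  by_contra hlt
  push Not at hlt
  have : d.CTheta * d.absLogThetaQ < -1 * d.absLogThetaQ := mul_lt_mul_of_pos_right hlt hA
  linarith

end LocusVolumeDatum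

end Summit.ABC.IUTFork.Joshi.ATS4

end
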